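import Mathlib
import HarnessLib

/-!
# NE7PositivityAssembly — THE ASSEMBLY SKELETON OF THE POSITIVITY LETTER (P_a): for a symmetric bilinear form `T` and a decomposition `b = t + g + r` (slice part, pure-gauge part,
# lift part) with DIAGONAL lower bounds `α·N_t(t)² ≤ T(t,t)`, `β·N_g(g)² ≤ T(g,g)`, `γ·N_r(r)² ≤ T(r,r)` and CROSS bounds `|T(t,g)| ≤ ε₁N_tN_g`, `|T(t,r)| ≤ ε₂N_tN_r`,
# `|T(g,r)| ≤ ε₃N_gN_r`, diagonal dominance gives `T(b,b) ≥ (α−ε₁−ε₂)N_t² + (β−ε₁−ε₃)N_g² + (γ−ε₂−ε₃)N_r²` — the three diagonals are F206 (slice, row NE3's tangent coercivity),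
# F210 (pure gauge), and the lift letters; the cross terms are F208-type tension bounds and `NE3EnergyHessTwoTerm` (file 140 of the curved (APE), F211)

Cell `pub-balaban`, rung (B)+1 sub-cell t4, lineage `b2b-balaban-t4-ne7-p1` (CRUX PROVER NE7 #1 = OWNER of row NE7), generation 85; memo
`t4/b2b-balaban-t4-ne7-p1-g85/LAGRANGE-CARRIER.md` §10–§11.  Mathlib only; companion of F207 `NE7CoercivityGaugeTransfer`.
WHY.  [B9] Thm 3.11 ∕ [B8] §1 prove positivity of `Δ_a(U)` by splitting a field into its slice, gauge and averaged components and dominating the cross terms; on our carrier the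
three diagonal bounds are (being) supplied separately (F206, F210, lift letters of `QbarRightInverseB8`).  THIS file is the final three-line algebra, so the successor's (P_a) file is
an instantiation: `T = ⟪·, softSymOpKa a ·⟫`, `t ∈ ker Qbar ∩ IsLandauB8`-transversal, `g = D_Wμ`, `r` = lift of `Qbar b`.
WHAT ([folklore]; 0 def, 0 sorry; Mathlib only).  `form_add3` (expansion of `T(t+g+r, t+g+r)`), **`posAssembly_lower`** (the diagonal-dominance lower bound), **`posAssembly_pos`**
(strict positivity when the three margins are positive and one of `N_t, N_g, N_r` is non-zero).
HONEST FRAMING (page 1): elementary algebra; nothing of the tree instantiated; (P_a) NOT proved; (KL-B) at curved `W` NOT proved; (APE) on curved data NOT proved; NOT ONE-STEP, NOT NE7;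
spine 0∕9; finite T⁴ rung (B)+1 — NOT infinite volume, NOT mass gap, NOT `BetaPertH`, NOT Clay.  Continuum YM on T⁴ ⇐ BetaPertH ∧ nine spine estimates (0/9 proved); BetaPertH ⇐
(D1) ∧ (D4) ∧ CAP+tail; G-an2-4 gates asym, D1 and NE2/3/4.
-/

set_option autoImplicit false

namespace Summit.QuantumFields.BalabanUV.T4Continuum.NE7PositivityAssembly

variable {V : Type*} [AddCommGroup V] [Module ℝ V]

/-- Expansion of a symmetric bilinear form on a three-term sum. [folklore] -/
theorem form_add3 (T : V →ₗ[ℝ] V →ₗ[ℝ] ℝ) (hsymm : ∀ u v : V, T u v = T v u) (t g r : V) :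
    T (t + g + r) (t + g + r) = T t t + T g g + T r r + 2 * T t g + 2 * T t r + 2 * T g r := by
  simp only [map_add, LinearMap.add_apply, hsymm g t, hsymm r t, hsymm r g]
  ring

/-- **DIAGONAL DOMINANCE**: with diagonal lower bounds `α N_t² ≤ T(t,t)`, `β N_g² ≤ T(g,g)`, `γ N_r² ≤ T(r,r)` and cross bounds `|T(t,g)| ≤ ε₁N_tN_g`, `|T(t,r)| ≤ ε₂N_tN_r`,
`|T(g,r)| ≤ ε₃N_gN_r` (`εᵢ ≥ 0`), `T(t+g+r, t+g+r) ≥ (α−ε₁−ε₂)N_t² + (β−ε₁−ε₃)N_g² + (γ−ε₂−ε₃)N_r²`. [folklore] -/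
theorem posAssembly_lower (T : V →ₗ[ℝ] V →ₗ[ℝ] ℝ) (hsymm : ∀ u v : V, T u v = T v u) (t g r : V)
    {Nt Ng Nr α β γ ε₁ ε₂ ε₃ : ℝ} (hε₁ : 0 ≤ ε₁) (hε₂ : 0 ≤ ε₂) (hε₃ : 0 ≤ ε₃)
    (ht : α * Nt ^ 2 ≤ T t t) (hg : β * Ng ^ 2 ≤ T g g) (hr : γ * Nr ^ 2 ≤ T r r)
    (htg : |T t g| ≤ ε₁ * Nt * Ng) (htr : |T t r| ≤ ε₂ * Nt * Nr) (hgr : |T g r| ≤ ε₃ * Ng * Nr) :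
    (α - ε₁ - ε₂) * Nt ^ 2 + (β - ε₁ - ε₃) * Ng ^ 2 + (γ - ε₂ - ε₃) * Nr ^ 2 ≤ T (t + g + r) (t + g + r) := by
  rw [form_add3 T hsymm]
  have h1 := (abs_le.mp htg).1
  have h2 := (abs_le.mp htr).1
  have h3 := (abs_le.mp hgr).1
  -- `2εNN' ≤ ε(N² + N'²)` for `ε ≥ 0`
  nlinarith [mul_nonneg hε₁ (sq_nonneg (Nt - Ng)), mul_nonneg hε₂ (sq_nonneg (Nt - Nr)), mul_nonneg hε₃ (sq_nonneg (Ng - Nr))]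

/-- **STRICT POSITIVITY FROM THE THREE MARGINS**: if `α > ε₁+ε₂`, `β > ε₁+ε₃`, `γ > ε₂+ε₃` and one of `N_t, N_g, N_r` is positive, `0 < T(b,b)` for `b = t + g + r`. [folklore] -/
theorem posAssembly_pos (T : V →ₗ[ℝ] V →ₗ[ℝ] ℝ) (hsymm : ∀ u v : V, T u v = T v u) (t g r : V)
    {Nt Ng Nr α β γ ε₁ ε₂ ε₃ : ℝ} (hε₁ : 0 ≤ ε₁) (hε₂ : 0 ≤ ε₂) (hε₃ : 0 ≤ ε₃)
    (ht : α * Nt ^ 2 ≤ T t t) (hg : β * Ng ^ 2 ≤ T g g) (hr : γ * Nr ^ 2 ≤ T r r)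
    (htg : |T t g| ≤ ε₁ * Nt * Ng) (htr : |T t r| ≤ ε₂ * Nt * Nr) (hgr : |T g r| ≤ ε₃ * Ng * Nr)
    (hα : ε₁ + ε₂ < α) (hβ : ε₁ + ε₃ < β) (hγ : ε₂ + ε₃ < γ) (hne : Nt ≠ 0 ∨ Ng ≠ 0 ∨ Nr ≠ 0) :
    0 < T (t + g + r) (t + g + r) := by
  have hlow := posAssembly_lower T hsymm t g r hε₁ hε₂ hε₃ ht hg hr htg htr hgr
  have h1 : 0 ≤ (α - ε₁ - ε₂) * Nt ^ 2 := mul_nonneg (by linarith) (sq_nonneg _)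
  have h2 : 0 ≤ (β - ε₁ - ε₃) * Ng ^ 2 := mul_nonneg (by linarith) (sq_nonneg _)
  have h3 : 0 ≤ (γ - ε₂ - ε₃) * Nr ^ 2 := mul_nonneg (by linarith) (sq_nonneg _)
  rcases hne with h | h | h
  · have : 0 < (α - ε₁ - ε₂) * Nt ^ 2 := mul_pos (by linarith) (by positivity)
    linarith
  · have : 0 < (β - ε₁ - ε₃) * Ng ^ 2 := mul_pos (by linarith) (by positivity)
    linarith
  · have : 0 < (γ - ε₂ - ε₃) * Nr ^ 2 := mul_pos (by linarith) (by positivity)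
    linarith

end Summit.QuantumFields.BalabanUV.T4Continuum.NE7PositivityAssembly
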